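import Literature.Barriers.QuantumAdvantage.PPolyOraclesBridges
import Literature.Barriers.QuantumAdvantage.PPolyOraclesSampToLanguage
import Literature.Barriers.QuantumAdvantage.PPolyOraclesAssembly
import Literature.Barriers.QuantumAdvantage.PPolyOraclesCompile
import Literature.Computability.Complexity.HashBricks
import Literature.Computability.Cryptography.LubyRackoffHybridProofs
import Literature.Computability.Cryptography.PseudorandomGeneratorsStretchOne
import Literature.Computability.Cryptography.ZhandryPRFModProofs
import Literature.Computability.QuantumComplexity.CountingSimulationRelProofs
import HarnessLib

/-!
# Discharge of the padding fact `verdictSampling_mem_SampBQPRel`; the sampling form of Aaronson–Chen's Thm. 7.6 from its language form ALONE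

Proof file (theorems only) of `PPolyOraclesBridges.lean` (barrier `PPolyOracles`, Aaronson–Chen
2017, Thms. 7.6 and 8.1 [AaronsonChen2017]). Subject: the SAMPLING form of Thm. 7.6 — §1 p. 10:
"Relative to some efficiently computable oracle, we can prove `SampBPP ≠ SampBQP`, but only under a
weak computational assumption, like the existence of one-way functions"; Thm. 7.6, p. 30, prints
the language form `BPP^O ≠ BQP^O` — i.e. the statement `OWFExist → PPolyOracleSamplingSeparation`
over the entry file's technique class. In `PPolyOraclesBridges.lean` the bridge
`h₄ = BQPRel_subset_BPPRel_of_sampBQPRel_subset` ("and consequently `BPP^O = BQP^O`", Thm. 8.1,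
p. 32) was proved from the one-bit padding fact `verdictSampling_mem_SampBQPRel` (the verdict of a
uniform Clifford+T oracle family, as a one-bit sampling problem, is in `SampBQP^A`; Aaronson–Chen
§2.2, canonical form of `SampBQP` oracle algorithms, p. 12). Meanwhile the tree PROVES the bridge
outright (`BQPRel_subset_BPPRel_of_sampBQPRel_subset_holds`, `PPolyOraclesSampToLanguage.lean`,
whose quantum half `uniformKernel_map_mem_SampBQPRel` — any polynomial-time post-processing of the
measured output of a uniform oracle family is a `SampBQP^A` problem, by the relativized classical
wrap `exists_uniform_classicalWrap_rel` of `QuantumComplexity/CWrapKernelRel.lean` — contains the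
padding fact as the instance `post = headBitFn`), and the other bridge `h₃ = BPP^A ⊆ BQP^A` as well
(`Literature.Computability.QuantumComplexity.BPPRel_ofLanguage_subset_BQPRel_holds`,
`QuantumComplexity/CountingSimulationRelProofs.lean`, from the discharged relativized reversible
simulation `uniformOracleCoinSimulation_holds`, `QuantumComplexity/CoinFamilyKernelProofs.lean`).
This file records the consequences:

* **`verdictSampling_mem_SampBQPRel_holds`** — discharge of the named fact of
  `PPolyOraclesBridges.lean`, as that instance (`headBitFn w = [w.headD false]`,
  `Complexity/HashBricks.lean`);
* **`aaronsonChen2017_thm76_samp_of_thm76`** — the sampling form of Thm. 7.6 from its language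
  form and the relativized reversible simulation:
  `aaronsonChen2017_thm76 → uniformOracleCoinSimulation → OWFExist → PPolyOracleSamplingSeparation`
  (bridge `h₃` by `BPPRel_ofLanguage_subset_BQPRel_of_sim`, `QuantumComplexity/BPPRelSubsetBQPRel.lean`;
  bridge `h₄` discharged), and `aaronsonChen2017_thm76_samp_of_thm76_leaves` (down to HILL, GGM,
  Luby–Rackoff, the §7.2–7.3 fact `aaronsonChen2017_thm76_of_prp` and `uniformOracleCoinSimulation`);
* **`pPolyOracleSamplingSeparation_of_thm76`** — the sampling form of Thm. 7.6 from the
  language-form fact `aaronsonChen2017_thm76` ALONE, every model bridge being a tree theorem: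
  `aaronsonChen2017_thm76 → OWFExist → PPolyOracleSamplingSeparation`.

**Revision 2 (review of the split, D-0026, 2026-08-15).** The sampling form used to be carried by
a separate named fact `aaronsonChen2017_thm76_samp : OWFExist → PPolyOracleSamplingSeparation`
(`PPolyOraclesProofs.lean`, Revision 2 there), minted as a decomposition child. With both bridges
discharged, that child's whole proof obligation IS the language-form fact `aaronsonChen2017_thm76`
(Thm. 7.6 as printed) — it was a corollary of its sibling, not a part of any proof — so it is
MERGED back: the `def` is retired and every theorem that concluded it keeps its name and states
the unfolded conclusion `OWFExist → PPolyOracleSamplingSeparation` (this file: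
`aaronsonChen2017_thm76_samp_of_thm76`, `…_leaves`, `…_thm76'`). Nothing printed is lost: the
§1 p. 10 sentence is `pPolyOracleSamplingSeparation_of_thm76`, conditional on exactly the printed
Thm. 7.6, whose discharge `aaronsonChen2017_thm76_holds` is tracked by `PPolyOraclesThm76.lean` /
`PPolyOraclesAssembly.lean` (five leaves: HILL `PRGExist_iff_OWFExist`, `LubyRackoff.HybridStep`,
`aaronsonChen2017_lem75_prfMod_isPRF`, `aaronsonChen2017_lem75_quantum`, `acLang_bppCompiles`).

**Revision 3 (2026-08-15, the sampling form of Thm. 7.6: two leaves left).** By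
`pPolyOracleSamplingSeparation_of_thm76` the sampling form `OWFExist → PPolyOracleSamplingSeparation`
awaits `aaronsonChen2017_thm76_holds` and nothing else. Of the five leaves of Thm. 7.6 listed above,
three are meanwhile tree theorems — `LubyRackoff.HybridStep_holds`
(`Cryptography/LubyRackoffHybridProofs.lean`), `aaronsonChen2017_lem75_prfMod_isPRF_holds`
(`Cryptography/ZhandryPRFModProofs.lean`), `acLang_bppCompiles_holds` (`PPolyOraclesCompile.lean`)
— and of HILL only the direction `OWFExist → PRGExist` is used (the converse is the tree theorem
`OWFExist_of_PRGExist`, `Cryptography/PseudorandomGeneratorsStretchOne.lean`). The section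
"Revision 3" imports these discharges next to the assembly `aaronsonChen2017_thm76_of_frontier₅`
(`PPolyOraclesAssembly.lean`), checks that they elaborate together, and proves the sampling form
from exactly the TWO named facts still open in the tree: HILL in the direction
`OWFExist → PRGExist` (`Cryptography/Pseudorandomness.lean`, `PRGExist_iff_OWFExist`;
Håstad–Impagliazzo–Levin–Luby 1999, Thm. 1.1) and the quantum machine of Lemma 7.5 (2)–(3)
(`Literature.Barriers.QuantumAdvantage.aaronsonChen2017_lem75_quantum`, `PPolyOraclesThm76.lean`):
`aaronsonChen2017_thm76_samp_of_hill`, `aaronsonChen2017_thm76_samp_of_frontier₂`. The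
unconditional sampling form will be `aaronsonChen2017_thm76_samp_of_frontier₂` applied to the two
outstanding `_holds` (equivalently `pPolyOracleSamplingSeparation_of_thm76 aaronsonChen2017_thm76_holds`).
(Revision 2 applies here too: these theorems state the unfolded conclusion
`OWFExist → PPolyOracleSamplingSeparation`; the separate named fact `aaronsonChen2017_thm76_samp`
is retired by the review of the split, its obligation being exactly `aaronsonChen2017_thm76_holds`.)

## Sources

* [AaronsonChen2017] arXiv:1612.05903 (held, `lit read arxiv:1612.05903`): §1 p. 10, ll. 1–7
  ("Relative to some efficiently computable oracle, we can prove `SampBPP ≠ SampBQP`, but only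
  under … the existence of one-way functions"), §2.2 (canonical form of `SampBQP` oracle
  algorithms, p. 12), Thm. 7.6 (p. 30, ll. 16–41), Thm. 8.1 with "and consequently `BPP^O = BQP^O`"
  (p. 32); re-read 2026-08-15 for Revision 2.
-/

noncomputable section

namespace Literature.Barriers.QuantumAdvantage

open _root_.Computability Literature.Computability.Complexity Literature.Computability.Complexity.Classes
  Literature.Computability.Cryptography Literature.Computability.QuantumComplexity

/-! ### Discharge of the padding fact -/

/-- The verdict problem is the measured output post-processed by the one-bit test `headBitFn`.
[folklore] -/
theorem verdictSampling_eq_map_headBitFn (F : QCircuitFamily cliffordT) (A : Language Bool) :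
    verdictSampling F A = fun x => (F.kernel A x).map HashBricks.headBitFn := by
  funext x
  have h : (HashBricks.headBitFn : List Bool → List Bool) = fun o => [o.headD false] :=
    funext HashBricks.headBitFn_apply
  rw [h]
  rfl

/-- **Discharge of `verdictSampling_mem_SampBQPRel`** (the quantum half of the bridge `h₄` in
`PPolyOraclesBridges.lean`): the verdict of a uniform oracle family is a `SampBQP^A` problem — the
instance `post = headBitFn` of the tree's `uniformKernel_map_mem_SampBQPRel` (any polynomial-time
post-processing of the measured output of a uniform Clifford+T oracle family is sampled exactly by a
uniform family fed `|⟨x, 1^k⟩⟩`, by the relativized classical wrap).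
[cite: AaronsonChen2017, §2.2 (canonical form of SampBQP oracle algorithms, p. 12)] -/
theorem verdictSampling_mem_SampBQPRel_holds : verdictSampling_mem_SampBQPRel := by
  intro A F hU
  rw [verdictSampling_eq_map_headBitFn]
  exact uniformKernel_map_mem_SampBQPRel A hU HashBricks.headBitFn_mem_FP

/-! ### Theorem 7.6 in sampling form from its language form -/

/-- **Aaronson–Chen 2017, Thm. 7.6 in sampling form, from its language form and the relativized
reversible simulation**: one-way functions give `O ∈ P/poly` with `BPP^O ≠ BQP^O`
(`aaronsonChen2017_thm76`); since `BPP^O ⊆ BQP^O` (`BPPRel_ofLanguage_subset_BQPRel_of_sim`, from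
`uniformOracleCoinSimulation`) and `SampBQP^O ⊆ SampBPP^O ⟹ BQP^O ⊆ BPP^O` (the discharged bridge
`BQPRel_subset_BPPRel_of_sampBQPRel_subset_holds`), the sampling classes differ too. (Revision 2:
conclusion stated unfolded, `OWFExist → PPolyOracleSamplingSeparation`; formerly the retired
named fact `aaronsonChen2017_thm76_samp`.) [cite: AaronsonChen2017, §1 (p. 10) and Thm. 7.6 (p. 30)] -/
theorem aaronsonChen2017_thm76_samp_of_thm76 (h76 : aaronsonChen2017_thm76)
    (hsim : uniformOracleCoinSimulation) (howf : OWFExist) : PPolyOracleSamplingSeparation :=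
  pPolyOracleSamplingSeparation_of_pPolyOracleSeparation' (BPPRel_ofLanguage_subset_BQPRel_of_sim hsim)
    (h76 howf)

/-- **Thm. 7.6 in sampling form from the leaves**: HILL (`PRGExist_iff_OWFExist`), GGM
(`PRFExist_of_PRGExist`), Luby–Rackoff (`PRPExist_of_PRFExist`), the §7.2–7.3 fact
(`aaronsonChen2017_thm76_of_prp`, decomposed in `PPolyOraclesThm76.lean`) and the relativized
reversible simulation (`uniformOracleCoinSimulation`).
[cite: AaronsonChen2017, Lemma 7.4, Thm. 7.6 (pp. 29–30) and §1 (p. 10)] -/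
theorem aaronsonChen2017_thm76_samp_of_thm76_leaves (hHILL : PRGExist_iff_OWFExist)
    (hGGM : PRFExist_of_PRGExist) (hLR : PRPExist_of_PRFExist)
    (h76 : aaronsonChen2017_thm76_of_prp) (hsim : uniformOracleCoinSimulation) (howf : OWFExist) :
    PPolyOracleSamplingSeparation :=
  aaronsonChen2017_thm76_samp_of_thm76 (aaronsonChen2017_thm76_of_parts' hHILL hGGM hLR h76) hsim howf

/-- The same through the sibling route (`aaronsonChen2017_thm76_samp_of_sim` of
`PPolyOraclesBridges.lean`, with the padding fact discharged) — a consistency check that the two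
sibling files agree. [cite: AaronsonChen2017, §1 (p. 10) and Thm. 7.6 (p. 30)] -/
theorem aaronsonChen2017_thm76_samp_of_thm76' (h76 : aaronsonChen2017_thm76)
    (hsim : uniformOracleCoinSimulation) (howf : OWFExist) : PPolyOracleSamplingSeparation :=
  aaronsonChen2017_thm76_samp_of_sim h76 hsim verdictSampling_mem_SampBQPRel_holds howf

/-! ### Revision 2: the sampling form from the language-form fact alone (all bridges discharged) -/

/-- **A language separation relative to `O ∈ P/poly` is a sampling separation relative to `O`,
unconditionally in the tree's models**: both bridges of
`pPolyOracleSamplingSeparation_of_pPolyOracleSeparation` are tree theorems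
(`BPPRel_ofLanguage_subset_BQPRel_holds`, Bernstein–Vazirani relativized;
`BQPRel_subset_BPPRel_of_sampBQPRel_subset_holds`, "and consequently").
[cite: AaronsonChen2017, Thm. 8.1 ("and consequently BPP^O = BQP^O", p. 32)] -/
theorem PPolyOracleSeparation.samplingSeparation (hsep : PPolyOracleSeparation) :
    PPolyOracleSamplingSeparation :=
  pPolyOracleSamplingSeparation_of_pPolyOracleSeparation' BPPRel_ofLanguage_subset_BQPRel_holds hsep

/-- **Aaronson–Chen 2017, Thm. 7.6 in sampling form, from the printed Thm. 7.6 ALONE** (§1,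
p. 10: "Relative to some efficiently computable oracle, we can prove `SampBPP ≠ SampBQP`, but only
under a weak computational assumption, like the existence of one-way functions"): given the
language-form fact `aaronsonChen2017_thm76` ("Assuming one-way functions exist, there exists an
oracle `O ∈ P/poly` such that `BPP^O ≠ BQP^O`", p. 30), one-way functions give `O ∈ P/poly` with
`SampBPP^O ≠ SampBQP^O`. This is the merged form of the retired decomposition child
`aaronsonChen2017_thm76_samp`: its only open leaf is `aaronsonChen2017_thm76_holds`
(`PPolyOraclesThm76.lean`, `PPolyOraclesAssembly.lean`).
[cite: AaronsonChen2017, §1 (p. 10) and Thm. 7.6 (p. 30)] -/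
theorem pPolyOracleSamplingSeparation_of_thm76 (h76 : aaronsonChen2017_thm76) (howf : OWFExist) :
    PPolyOracleSamplingSeparation :=
  (h76 howf).samplingSeparation

/-- The same fed from the barrier conjunction `PPolyOracles` of the entry file (its first
conjunct is Thm. 7.6): the evasion "one-way functions suffice", sampling form, with no bridge
hypotheses left (compare `pPolyOracleSamplingSeparation_of_owf` of `PPolyOraclesProofs.lean`).
[cite: AaronsonChen2017, §1 (p. 10) and Thm. 7.6 (p. 30)] -/
theorem pPolyOracleSamplingSeparation_of_PPolyOracles (h : PPolyOracles) (howf : OWFExist) :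
    PPolyOracleSamplingSeparation :=
  pPolyOracleSamplingSeparation_of_thm76 h.thm76 howf

/-! ### Revision 3: the sampling form of Thm. 7.6 from the two leaves still open (HILL `→`, Lemma 7.5 (2)–(3)) -/

/-- **HILL is used only in the direction `OWFExist → PRGExist`**: the converse direction of the
named fact `PRGExist_iff_OWFExist` is the tree theorem `OWFExist_of_PRGExist` (a generator of
stretch `n + 1`, truncated, is one-way; Goldreich 2001, §3.3.6).
[cite: HastadImpagliazzoLevinLuby1999, Thm. 1.1] [cite: Goldreich2001, §3.3.6 and Thm. 3.5.12] -/
theorem PRGExist_iff_OWFExist_of_hill (hHILL : OWFExist → PRGExist) : PRGExist_iff_OWFExist :=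
  ⟨OWFExist_of_PRGExist, hHILL⟩

/-- **Lemma 7.4 from HILL alone** ("if one-way functions exist, then there exist secure PRFs and
PRPs"): `OWFExist → PRGExist` (HILL, hypothesis) `→ PRFExist` (GGM, the tree theorem
`PRFExist_of_PRGExist_holds`) `→ PRPExist` (Luby–Rackoff, the tree theorems
`LubyRackoff.HybridStep_holds` and `LubyRackoff.MainLemma_holds` through `PRPExist_of_hybridStep`).
[cite: AaronsonChen2017, Lemma 7.4 (p. 29: "[HILL99, GGM86, GL89, LR88]")] -/
theorem aaronsonChen2017_lem74_of_hill (hHILL : OWFExist → PRGExist) :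
    OWFExist → PRFExist ∧ PRPExist :=
  aaronsonChen2017_lem74_of_parts (PRGExist_iff_OWFExist_of_hill hHILL) PRFExist_of_PRGExist_holds
    (PRPExist_of_hybridStep LubyRackoff.HybridStep_holds)

/-- **Aaronson–Chen 2017, Thm. 7.6 in sampling form, from the two leaves still open**: HILL in the
direction `OWFExist → PRGExist` and the `BQP^O` machine of Lemma 7.5 (2)–(3)
(`aaronsonChen2017_lem75_quantum` of `PPolyOraclesThm76.lean`). Everything else on the printed
road is a tree theorem: GGM and Luby–Rackoff (`aaronsonChen2017_lem74_of_hill`), the switching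
half and the `PRF^mod` half of Lemma 7.5 (1) (`aaronsonChen2017_lem75_prp_isPRF_holds`,
`aaronsonChen2017_lem75_prfMod_isPRF_holds`), the compilation of a `BPP^O` machine into a PRF
adversary (`acLang_bppCompiles_holds`), "consequently `O ∈ P/poly`"
(`aaronsonChen2017_thm76_ppoly_holds`), the diagonalization
(`aaronsonChen2017_thm76_of_prp_of_leaves₂`, `PPolyOraclesCompile.lean`), and both model bridges
to the sampling classes (`pPolyOracleSamplingSeparation_of_thm76`).
[cite: AaronsonChen2017, §1 (p. 10), Lemma 7.4, Lemma 7.5, Thm. 7.6 (pp. 29–30)] -/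
theorem aaronsonChen2017_thm76_samp_of_hill (hHILL : OWFExist → PRGExist)
    (hq : Literature.Barriers.QuantumAdvantage.aaronsonChen2017_lem75_quantum) (howf : OWFExist) :
    PPolyOracleSamplingSeparation :=
  pPolyOracleSamplingSeparation_of_thm76
    (aaronsonChen2017_thm76_of_parts (aaronsonChen2017_lem74_of_hill hHILL)
      (aaronsonChen2017_thm76_of_prp_of_leaves₂ aaronsonChen2017_lem75_prfMod_isPRF_holds hq))
    howf

/-- **The same from the two named facts as declared** (`PRGExist_iff_OWFExist` whole and
`aaronsonChen2017_lem75_quantum`), through the sibling assembly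
`aaronsonChen2017_thm76_of_frontier₅` of `PPolyOraclesAssembly.lean` fed with the three discharged
leaves `LubyRackoff.HybridStep_holds`, `aaronsonChen2017_lem75_prfMod_isPRF_holds`,
`acLang_bppCompiles_holds` — a consistency check that the two assemblies agree. The unconditional
sampling form of Thm. 7.6 is this theorem applied to the two outstanding `_holds`.
[cite: AaronsonChen2017, §1 (p. 10) and Thm. 7.6 (p. 30)] -/
theorem aaronsonChen2017_thm76_samp_of_frontier₂ (hHILL : PRGExist_iff_OWFExist)
    (hq : Literature.Barriers.QuantumAdvantage.aaronsonChen2017_lem75_quantum) (howf : OWFExist) :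
    PPolyOracleSamplingSeparation :=
  pPolyOracleSamplingSeparation_of_thm76
    (aaronsonChen2017_thm76_of_frontier₅ hHILL LubyRackoff.HybridStep_holds
      aaronsonChen2017_lem75_prfMod_isPRF_holds hq acLang_bppCompiles_holds)
    howf

/-- The two Revision-3 roads agree with each other on the HILL hypothesis: the whole named fact
gives its `→` direction. [cite: AaronsonChen2017, Thm. 7.6 (p. 30)] -/
theorem aaronsonChen2017_thm76_samp_of_frontier₂' (hHILL : PRGExist_iff_OWFExist)
    (hq : Literature.Barriers.QuantumAdvantage.aaronsonChen2017_lem75_quantum) (howf : OWFExist) :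
    PPolyOracleSamplingSeparation :=
  aaronsonChen2017_thm76_samp_of_hill hHILL.mpr hq howf

end Literature.Barriers.QuantumAdvantage

end
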